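import Literature.Computability.Cryptography.Harvey2021Integer
import HarnessLib

/-!
# Harvey 2021: the supply of an element of large order as a function, and its correctness

Continuing `Harvey2021Integer.lean` (the number theory of Hittmeir's order-finding loop:
`run_pow_eq_one_absurd`, `dvd_pred_of_order_checks`, `two_mul_le_lcm_of_pow`, `exists_ap_minFac`,
`ap_hit_proper`).  Harvey's Prop. 2.7 cites Hittmeir 2018 (Alg. 6.1 and the theorem after it): given
`N` and `D ≥ N^{2/5}`, find `α ∈ (ℤ/N)^*` of order `> D`, or a factor, or prove `N` prime, in
`D^{1/2+o(1)}`.  The `N^{1/5+o(1)}` factoring bound only ever uses such an `α` through the weaker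
certificate "`α^x ≢ 1 (mod p)` for every prime `p ∣ N` and `1 ≤ x ≤ D`" with `D ≈ N^{1/5}`, and for
THAT the expensive parts of Hittmeir's algorithm (Sutherland's order computation, the residue-class
factoring of his Thm. 4.4) can be replaced by brute force within the same `N^{1/5+o(1)}` budget.
This file defines that simplified search as a pure function and proves it correct:

* `findBase` (the next base `a` with `a^M ≢ 1 (mod N)`, `≤ TR` trials, a gcd per trial),
  `oscan` (the exponents `1 … D`: stop at `a^i ≡ 1` — the order `k` — or at a proper
  `gcd(N, a^i mod N − 1)`), `apFirst` (the least hit of the scan of the class `1 (mod M)`),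
  `faPhase` / `faRun` (Hittmeir's main loop: `M := lcm(M, k)`; once `M > TH` the class scan decides),
  with their specifications `findBase_spec`, `oscan_spec`, `apFirst_some`/`apFirst_none`;
* **`faPhase_spec`** (one phase keeps the invariant — `M ∣ p − 1` for every prime `p ∣ N`,
  `M ≤ TH`, `M ≥ 2^t` after `t` phases — or reaches a certified outcome) and **`faRun_spec`**:
  after `PH` phases with `TH < 2^PH` the outcome is a proper factor, or a base `α` coprime to `N`
  with `α^j ≢ 1 (mod p)` for all primes `p ∣ N` and `1 ≤ j ≤ D`, or "`N` is prime" — under the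
  side conditions `TH + 1 ≤ TR ≤ minFac N` (consecutive bases are distinct nonzero residues),
  `⌊√N⌋ ≤ TH · T3` (the class scan reaches `minFac N`) and `1 + PH · TR < N` (bases stay below `N`).

The termination count is Hittmeir's (the modulus doubles per round); `run_pow_eq_one_absurd'` is
the root-counting step with the sharp hypothesis `M + 1 ≤ p`.  No named facts.

## References

* M. Hittmeir, *A babystep-giantstep method for faster deterministic integer factorization*,
  Math. Comp. 87 (2018) 2915–2935, §6, Algorithm 6.1 and the theorem following it
  (arXiv:1608.08766). [Hittmeir2018]
* D. Harvey, *An exponent one-fifth algorithm for deterministic integer factorisation*,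
  Math. Comp. 90 (2021), Prop. 2.7 (arXiv:2010.05450 Prop. 8) and the proof of Prop. 4.3
  (only `ord > m` is used). [Harvey2021]
-/

namespace Literature.Computability.Cryptography.Harvey2021

open Polynomial

namespace OrderSupply

/-! ### two more certificates -/

/-- **At most `M` consecutive bases with `a^M = 1`** (sharp form of `run_pow_eq_one_absurd`: only `M + 1 ≤ p` is needed): the `M + 1` integers `a₀+1, …, a₀+M+1` are distinct modulo the prime `p` and would all be roots of `X^M − 1`. [cite: Hittmeir2018, §6, proof of the theorem after Alg. 6.1 (termination)] -/
theorem run_pow_eq_one_absurd' {p M a0 : ℕ} (hp : p.Prime) (hM : 1 ≤ M) (hMp : M + 1 ≤ p)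
    (h : ∀ i, i ≤ M → (((a0 + 1 + i : ℕ) : ZMod p)) ^ M = 1) : False := by
  haveI : Fact p.Prime := ⟨hp⟩
  let f : ℕ → ZMod p := fun i => ((a0 + 1 + i : ℕ) : ZMod p)
  have hinj : Set.InjOn f (Finset.range (M + 1) : Finset ℕ) := by
    intro i hi i' hi' hii'
    simp only [Finset.coe_range, Set.mem_Iio] at hi hi'
    have h1 := (ZMod.natCast_eq_natCast_iff' _ _ p).1 hii'
    -- `a0+1+i ≡ a0+1+i' (mod p)` with `|i - i'| ≤ M < p`
    have h2 : (a0 + 1 + i) % p = (a0 + 1 + i') % p := h1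
    by_contra hne
    rcases Nat.lt_or_gt_of_ne hne with hlt | hlt
    · have := Nat.sub_mod_eq_zero_of_mod_eq h2.symm
      have hd : (a0 + 1 + i' - (a0 + 1 + i)) = i' - i := by omega
      rw [hd] at this
      have : p ∣ i' - i := Nat.dvd_of_mod_eq_zero this
      have := Nat.le_of_dvd (by omega) this
      omega
    · have := Nat.sub_mod_eq_zero_of_mod_eq h2
      have hd : (a0 + 1 + i - (a0 + 1 + i')) = i - i' := by omega
      rw [hd] at this
      have : p ∣ i - i' := Nat.dvd_of_mod_eq_zero this
      have := Nat.le_of_dvd (by omega) this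
      omega
  have hcard : ((Finset.range (M + 1)).image f).card = M + 1 := by
    rw [Finset.card_image_of_injOn hinj, Finset.card_range]
  have hsub : (Finset.range (M + 1)).image f ⊆ (Polynomial.nthRoots M (1 : ZMod p)).toFinset := by
    intro x hx
    simp only [Finset.mem_image, Finset.mem_range] at hx
    obtain ⟨i, hi, rfl⟩ := hx
    rw [Multiset.mem_toFinset, Polynomial.mem_nthRoots (by omega)]
    exact h i (by omega)
  have h1 := Finset.card_le_card hsub
  have h2 : (Polynomial.nthRoots M (1 : ZMod p)).toFinset.card ≤ M :=
    (Multiset.toFinset_card_le _).trans (Polynomial.card_nthRoots M 1)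
  omega

/-- A passed gcd check `gcd (N, a^j mod N − 1) = 1` certifies `a^j ≠ 1` in `ℤ/p` for every prime `p ∣ N`. [cite: Hittmeir2018, Lemma 2.2] -/
theorem pow_ne_one_of_gcd_check {N p a j : ℕ} (hp : p.Prime) (hpN : p ∣ N) (hg : Nat.gcd N (a ^ j % N - 1) = 1) :
    (a : ZMod p) ^ j ≠ 1 := by
  intro h1
  rw [← cast_pow_mod hpN] at h1
  have h2 := hp.two_le
  have hm : (a ^ j % N) % p = 1 := by
    have := (ZMod.natCast_eq_natCast_iff' _ 1 p).1 (by rw [h1, Nat.cast_one])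
    rwa [Nat.mod_eq_of_lt (show 1 < p by omega)] at this
  have hge : 1 ≤ a ^ j % N := by
    rcases Nat.eq_zero_or_pos (a ^ j % N) with h0 | h0
    · rw [h0, Nat.zero_mod] at hm; exact absurd hm (by omega)
    · exact h0
  have hdvd : p ∣ a ^ j % N - 1 :=
    (Nat.modEq_iff_dvd' hge).1 (by rw [Nat.ModEq, Nat.mod_eq_of_lt (show 1 < p by omega), hm])
  have : p ∣ Nat.gcd N (a ^ j % N - 1) := Nat.dvd_gcd hpN hdvd
  rw [hg] at this
  exact hp.one_lt.ne' (Nat.dvd_one.1 this)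

/-! ### the functional model -/

/-- Find the next base: at most `t` trials after `a`; `(a', code, g)` with `code = 1`: `g = gcd (a', N) > 1`; `code = 2`: `a'` coprime with `a'^M mod N ≠ 1`; `code = 0`: none. [cite: Hittmeir2018, Alg. 6.1, Steps 3–6] -/
def findBase (N M : ℕ) : ℕ → ℕ → ℕ × ℕ × ℕ
  | 0, a => (a, 0, 0)
  | t + 1, a =>
    if 1 < Nat.gcd (a + 1) N then (a + 1, 1, Nat.gcd (a + 1) N)
    else if (a + 1) ^ M % N ≠ 1 then (a + 1, 2, 0)
    else findBase N M t (a + 1)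

/-- The order scan from exponent `i` with `f` exponents left: `(1, g)` a proper factor `g`; `(2, 0)` no power is `1`; `(3, k)` the order `k`. [cite: Hittmeir2018, Alg. 6.1, Steps 7–15 (by brute force)] -/
def oscan (N a : ℕ) : ℕ → ℕ → ℕ × ℕ
  | 0, _ => (2, 0)
  | f + 1, i =>
    if a ^ i % N = 1 then (3, i)
    else if 1 < Nat.gcd N (a ^ i % N - 1) ∧ Nat.gcd N (a ^ i % N - 1) < N then (1, Nat.gcd N (a ^ i % N - 1))
    else oscan N a f (i + 1)

/-- The least `k' ∈ [1, T]` with `gcd (1 + M k', N) > 1`, if any (the scan of the class `1 (mod M)`, Step 18). [cite: Hittmeir2018, Alg. 6.1, Step 18] -/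
def apFirst (N M T : ℕ) : Option ℕ := ((List.range T).find? fun k => 1 < Nat.gcd (1 + M * (k + 1)) N).map (· + 1)

/-- The state of the search: last base tried, modulus of the congruence `p ≡ 1`, result code (`0` running, `1` factor, `2` base found, `3` prime), output. [folklore] -/
structure FaState where
  a : ℕ
  M : ℕ
  res : ℕ
  out : ℕ

/-- One round of the main loop. [cite: Hittmeir2018, Alg. 6.1] -/
def faPhase (N D TH TR T3 : ℕ) (st : FaState) : FaState :=
  if st.res ≠ 0 then st else
  let fb := findBase N st.M TR st.a
  if fb.2.1 = 1 then ⟨fb.1, st.M, 1, fb.2.2⟩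
  else if fb.2.1 = 0 then ⟨fb.1, st.M, 0, 0⟩
  else
    let os := oscan N fb.1 D 1
    if os.1 = 1 then ⟨fb.1, st.M, 1, os.2⟩
    else if os.1 = 2 then ⟨fb.1, st.M, 2, fb.1⟩
    else
      let M' := Nat.lcm st.M os.2
      if TH < M' then
        match apFirst N M' T3 with
        | some k' => if Nat.gcd (1 + M' * k') N < N then ⟨fb.1, M', 1, Nat.gcd (1 + M' * k') N⟩ else ⟨fb.1, M', 3, 0⟩
        | none => ⟨fb.1, M', 3, 0⟩
      else ⟨fb.1, M', 0, 0⟩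

/-- The whole search: `PH` rounds from `a = 1`, `M = 1`. [cite: Hittmeir2018, Alg. 6.1] -/
def faRun (N D TH TR T3 PH : ℕ) : FaState := (faPhase N D TH TR T3)^[PH] ⟨1, 1, 0, 0⟩

/-! ### specifications of the pieces -/

/-- What the base search returns. [folklore] -/
theorem findBase_spec (N M : ℕ) (hN : 1 < N) : ∀ t a, let fb := findBase N M t a
    a ≤ fb.1 ∧ fb.1 ≤ a + t ∧
    (fb.2.1 = 0 ∨ fb.2.1 = 1 ∨ fb.2.1 = 2) ∧
    (fb.2.1 = 1 → 1 < fb.2.2 ∧ fb.2.2 ∣ N ∧ fb.2.2 ∣ fb.1 ∧ a < fb.1) ∧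
    (fb.2.1 = 2 → Nat.Coprime fb.1 N ∧ fb.1 ^ M % N ≠ 1 ∧ a < fb.1) ∧
    (∀ a', a < a' → a' < fb.1 → Nat.Coprime a' N ∧ a' ^ M % N = 1) ∧
    (fb.2.1 ≠ 1 → ∀ a', a < a' → a' ≤ fb.1 → Nat.Coprime a' N) ∧
    (fb.2.1 = 0 → fb.1 = a + t ∧ ∀ a', a < a' → a' ≤ a + t → Nat.Coprime a' N ∧ a' ^ M % N = 1)
  | 0, a => by
    simp only [findBase]
    refine ⟨le_rfl, by omega, by simp, by simp, by simp, fun a' h1 h2 => by omega, fun _ a' h1 h2 => by omega, fun _ => ⟨rfl, fun a' h1 h2 => by omega⟩⟩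
  | t + 1, a => by
    intro fb
    have hg1 : ∀ x, 1 ≤ Nat.gcd x N := fun x => Nat.gcd_pos_of_pos_right _ (by omega)
    by_cases h1 : 1 < Nat.gcd (a + 1) N
    · have hfb : fb = (a + 1, 1, Nat.gcd (a + 1) N) := by simp [fb, findBase, h1]
      rw [hfb]
      refine ⟨by omega, by omega, Or.inr (Or.inl rfl), fun _ => ⟨h1, Nat.gcd_dvd_right _ _, Nat.gcd_dvd_left _ _, by omega⟩, by simp,
        fun a' h2 h3 => by simp at h3; omega, by simp, by simp⟩
    · have hcop : Nat.Coprime (a + 1) N := by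
        have := hg1 (a + 1); unfold Nat.Coprime; omega
      by_cases h2 : (a + 1) ^ M % N ≠ 1
      · have hfb : fb = (a + 1, 2, 0) := by simp [fb, findBase, h1, h2]
        rw [hfb]
        refine ⟨by omega, by omega, Or.inr (Or.inr rfl), by simp, fun _ => ⟨hcop, h2, by omega⟩, fun a' h3 h4 => by simp at h4; omega,
          fun _ a' h3 h4 => ?_, by simp⟩
        simp at h4; have : a' = a + 1 := by omega
        subst this; exact hcop
      · push Not at h2
        have hfb : fb = findBase N M t (a + 1) := by simp [fb, findBase, h1, h2]
        rw [hfb]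
        obtain ⟨i1, i2, i3, i4, i5, i6, i7, i8⟩ := findBase_spec N M hN t (a + 1)
        refine ⟨by omega, by omega, i3, fun h => ?_, fun h => ?_, fun a' h3 h4 => ?_, fun h a' h3 h4 => ?_, fun h => ?_⟩
        · obtain ⟨j1, j2, j3, j4⟩ := i4 h; exact ⟨j1, j2, j3, by omega⟩
        · obtain ⟨j1, j2, j3⟩ := i5 h; exact ⟨j1, j2, by omega⟩
        · rcases Nat.lt_or_ge (a + 1) a' with h5 | h5
          · exact i6 a' h5 h4
          · have : a' = a + 1 := by omega
            subst this; exact ⟨hcop, h2⟩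
        · rcases Nat.lt_or_ge (a + 1) a' with h5 | h5
          · exact i7 h a' h5 h4
          · have : a' = a + 1 := by omega
            subst this; exact hcop
        · obtain ⟨j1, j2⟩ := i8 h
          refine ⟨by omega, fun a' h3 h4 => ?_⟩
          rcases Nat.lt_or_ge (a + 1) a' with h5 | h5
          · exact j2 a' h5 (by omega)
          · have : a' = a + 1 := by omega
            subst this; exact ⟨hcop, h2⟩

/-- What the order scan returns (for a base coprime to `N`): a proper factor, or all checks passed, or the order with all earlier checks passed. [folklore] -/
theorem oscan_spec (N a : ℕ) (hN : 1 < N) (hcop : Nat.Coprime a N) : ∀ f i, 1 ≤ i → let os := oscan N a f i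
    (os.1 = 1 ∨ os.1 = 2 ∨ os.1 = 3) ∧
    (os.1 = 1 → 1 < os.2 ∧ os.2 < N ∧ os.2 ∣ N) ∧
    (os.1 = 2 → ∀ j, i ≤ j → j < i + f → a ^ j % N ≠ 1 ∧ Nat.gcd N (a ^ j % N - 1) = 1) ∧
    (os.1 = 3 → i ≤ os.2 ∧ os.2 < i + f ∧ a ^ os.2 % N = 1 ∧ ∀ j, i ≤ j → j < os.2 → a ^ j % N ≠ 1 ∧ Nat.gcd N (a ^ j % N - 1) = 1)
  | 0, i, hi => by
    simp only [oscan]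
    exact ⟨by simp, by simp, fun _ j h1 h2 => by omega, by simp⟩
  | f + 1, i, hi => by
    intro os
    by_cases h1 : a ^ i % N = 1
    · have hos : os = (3, i) := by simp [os, oscan, h1]
      rw [hos]
      exact ⟨Or.inr (Or.inr rfl), by simp, by simp, fun _ => ⟨le_rfl, by omega, h1, fun j h2 h3 => by omega⟩⟩
    · by_cases h2 : 1 < Nat.gcd N (a ^ i % N - 1) ∧ Nat.gcd N (a ^ i % N - 1) < N
      · have hos : os = (1, Nat.gcd N (a ^ i % N - 1)) := by simp [os, oscan, h1, h2]
        rw [hos]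
        exact ⟨Or.inl rfl, fun _ => ⟨h2.1, h2.2, Nat.gcd_dvd_left _ _⟩, by simp, by simp⟩
      · have hos : os = oscan N a f (i + 1) := by simp [os, oscan, h1, h2]
        -- the check at `i` passed: `gcd = 1` (`a^i mod N ≠ 0` by coprimality, so `gcd ≠ N`)
        have hgi : Nat.gcd N (a ^ i % N - 1) = 1 := by
          set x := a ^ i % N with hx
          have hxN : x < N := Nat.mod_lt _ (by omega)
          have hx0 : x ≠ 0 := by
            intro h0
            have hc : Nat.Coprime (a ^ i) N := Nat.Coprime.pow_left i hcop
            have : Nat.gcd (a ^ i) N = N := by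
              rw [Nat.gcd_comm, Nat.gcd_eq_left (Nat.dvd_of_mod_eq_zero h0)]
            rw [Nat.Coprime] at hc; omega
          have hle : Nat.gcd N (x - 1) ≤ N := Nat.le_of_dvd (by omega) (Nat.gcd_dvd_left _ _)
          have hneN : Nat.gcd N (x - 1) ≠ N := by
            intro hE
            have hdv := Nat.gcd_dvd_right N (x - 1)
            rw [hE] at hdv
            have h0 : x - 1 = 0 := Nat.eq_zero_of_dvd_of_lt hdv (by omega)
            omega
          have hpos : 1 ≤ Nat.gcd N (x - 1) := Nat.gcd_pos_of_pos_left _ (by omega)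
          push Not at h2
          by_contra hne
          have := h2 (by omega)
          omega
        rw [hos]
        obtain ⟨i1, i2, i3, i4⟩ := oscan_spec N a hN hcop f (i + 1) (by omega)
        refine ⟨i1, i2, fun h j h3 h4 => ?_, fun h => ?_⟩
        · rcases Nat.lt_or_ge i j with h5 | h5
          · exact i3 h j (by omega) (by omega)
          · have : j = i := by omega
            subst this; exact ⟨h1, hgi⟩
        · obtain ⟨j1, j2, j3, j4⟩ := i4 h
          refine ⟨by omega, by omega, j3, fun j h3 h4 => ?_⟩
          rcases Nat.lt_or_ge i j with h5 | h5
          · exact j4 j (by omega) h4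
          · have : j = i := by omega
            subst this; exact ⟨h1, hgi⟩

/-! ### the least hit of the class scan -/

/-- No hit: every candidate of the class up to `T` is coprime to `N`. [folklore] -/
theorem apFirst_none {N M T : ℕ} (h : apFirst N M T = none) : ∀ k, 1 ≤ k → k ≤ T → Nat.gcd (1 + M * k) N ≤ 1 := by
  intro k hk1 hk2
  unfold apFirst at h
  rw [Option.map_eq_none_iff, List.find?_eq_none] at h
  have := h (k - 1) (List.mem_range.2 (by omega))
  rw [show k - 1 + 1 = k by omega] at this
  simpa using this

/-- A hit is the least one. [folklore] -/
theorem apFirst_some {N M T k' : ℕ} (h : apFirst N M T = some k') :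
    1 ≤ k' ∧ k' ≤ T ∧ 1 < Nat.gcd (1 + M * k') N ∧ ∀ k, 1 ≤ k → k < k' → Nat.gcd (1 + M * k) N ≤ 1 := by
  unfold apFirst at h
  rw [Option.map_eq_some_iff] at h
  obtain ⟨j, hj, rfl⟩ := h
  rw [List.find?_eq_some_iff_append] at hj
  obtain ⟨hpj, as, bs, hsplit, hbefore⟩ := hj
  simp only [decide_eq_true_eq] at hpj
  have hlen : as.length = j ∧ j < T := by
    have h1 := congrArg List.length hsplit
    simp at h1
    have h2 : (List.range T)[as.length]? = some j := by
      rw [hsplit]; simp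
    rw [List.getElem?_range (by omega)] at h2
    simp at h2
    omega
  refine ⟨by omega, by omega, hpj, fun k hk1 hk2 => ?_⟩
  have hmem : k - 1 ∈ as := by
    have h3 : (List.range T)[k - 1]? = some (k - 1) := List.getElem?_range (by omega)
    rw [hsplit, List.getElem?_append_left (by omega)] at h3
    exact List.mem_of_getElem? h3
  have h5 : ¬ (1 < Nat.gcd (1 + M * (k - 1 + 1)) N) := by simpa using hbefore (k - 1) hmem
  rw [show k - 1 + 1 = k by omega] at h5
  omega

/-! ### the phases -/

section Run

variable {N D TH TR T3 : ℕ} (hN : 1 < N) (hTH : 1 ≤ TH) (hTR : TH + 1 ≤ TR) (hTRp : TR ≤ N.minFac) (hT3 : Nat.sqrt N ≤ TH * T3)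

/-- The standing invariant while running. [folklore] -/
structure FaInv (N TH : ℕ) (t : ℕ) (st : FaState) : Prop where
  hM1 : 1 ≤ st.M
  hMTH : st.M ≤ TH
  hres : st.res = 0
  hdvd : ∀ p, p.Prime → p ∣ N → st.M ∣ p - 1
  hgrow : 2 ^ t ≤ st.M

/-- What a finished state certifies: a proper factor; or a base `≤ bound`, coprime to `N`, with `α^j ≢ 1 (mod p)` for all primes `p ∣ N`, `1 ≤ j ≤ D`; or primality. [folklore] -/
def FaDone (N D : ℕ) (bound : ℕ) (st : FaState) : Prop :=
  (st.res = 1 ∧ 1 < st.out ∧ st.out < N ∧ st.out ∣ N) ∨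
  (st.res = 2 ∧ Nat.Coprime st.out N ∧ 2 ≤ st.out ∧ st.out ≤ bound ∧ ∀ p, p.Prime → p ∣ N → ∀ j, 1 ≤ j → j ≤ D → (st.out : ZMod p) ^ j ≠ 1) ∨
  (st.res = 3 ∧ N.Prime)

include hN hTR hTRp hT3 in

/-- **One round**: from the invariant, either the invariant with the modulus doubled or a certified outcome; finished states are kept; bases advance by at most `TR`. [cite: Hittmeir2018, §6, proof of the theorem after Alg. 6.1] -/
theorem faPhase_spec (t : ℕ) (st : FaState) (hbd : st.a + TR < N) :
    (FaInv N TH t st → (FaInv N TH (t + 1) (faPhase N D TH TR T3 st) ∨ FaDone N D (st.a + TR) (faPhase N D TH TR T3 st)) ∧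
      (faPhase N D TH TR T3 st).a ≤ st.a + TR) ∧
    (st.res ≠ 0 → faPhase N D TH TR T3 st = st) := by
  refine ⟨fun hI => ?_, fun hr => by rw [faPhase, if_pos hr]⟩
  obtain ⟨hM1, hMTH, hres, hdvd, hgrow⟩ := hI
  obtain ⟨f1, f2, f3, f4, f5, f6, f7, f8⟩ := findBase_spec N st.M hN TR st.a
  set fb := findBase N st.M TR st.a with hfb
  have hmf2 := (Nat.minFac_prime (show N ≠ 1 by omega)).two_le
  -- case analysis on the base search
  rcases f3 with hc | hc | hc
  · -- no base found: `TR ≥ M + 1` consecutive bases with `a^M = 1`, absurd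
    exfalso
    obtain ⟨g1, g2⟩ := f8 hc
    have hp := Nat.minFac_prime (show N ≠ 1 by omega)
    refine run_pow_eq_one_absurd' (p := N.minFac) (M := st.M) (a0 := st.a) hp hM1 (by omega) fun i hi => ?_
    obtain ⟨-, h2⟩ := g2 (st.a + 1 + i) (by omega) (by omega)
    have := cast_pow_mod (a := st.a + 1 + i) (j := st.M) (Nat.minFac_dvd N)
    rw [h2, Nat.cast_one] at this
    exact this.symm
  · -- a factor from the gcd
    have hph : faPhase N D TH TR T3 st = ⟨fb.1, st.M, 1, fb.2.2⟩ := by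
      simp [faPhase, hres, ← hfb, hc]
    rw [hph]
    obtain ⟨g1, g2, g3, g4⟩ := f4 hc
    refine ⟨Or.inr (Or.inl ⟨rfl, g1, ?_, g2⟩), f2⟩
    have : fb.2.2 ≤ fb.1 := Nat.le_of_dvd (by omega) g3
    simp only; omega
  · -- a candidate base `α = fb.1`
    obtain ⟨gcop, gM, glt⟩ := f5 hc
    obtain ⟨o1, o2, o3, o4⟩ := oscan_spec N fb.1 hN gcop D 1 le_rfl
    set os := oscan N fb.1 D 1 with hos
    have hc0 : fb.2.1 ≠ 0 := by omega
    have hc1 : fb.2.1 ≠ 1 := by omega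
    rcases o1 with ho | ho | ho
    · -- factor from the order scan
      have hph : faPhase N D TH TR T3 st = ⟨fb.1, st.M, 1, os.2⟩ := by
        simp [faPhase, hres, ← hfb, hc0, hc1, ← hos, ho]
      rw [hph]
      obtain ⟨g1, g2, g3⟩ := o2 ho
      exact ⟨Or.inr (Or.inl ⟨rfl, g1, g2, g3⟩), f2⟩
    · -- no power is one: the base has large order modulo every prime factor
      have hph : faPhase N D TH TR T3 st = ⟨fb.1, st.M, 2, fb.1⟩ := by
        simp [faPhase, hres, ← hfb, hc0, hc1, ← hos, ho]
      rw [hph]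
      refine ⟨Or.inr (Or.inr (Or.inl ⟨rfl, gcop, ?_, f2, fun p hp hpN j hj1 hj2 => ?_⟩)), f2⟩
      · -- `fb.1 ≥ 2`: `fb.1 ≠ 0` (coprime to `N > 1`) and `fb.1 ≠ 1` (`1^M mod N = 1`)
        show 2 ≤ fb.1
        by_contra hlt
        have h1 : fb.1 = 0 ∨ fb.1 = 1 := by omega
        rcases h1 with h1 | h1
        · rw [h1] at gcop; rw [Nat.Coprime, Nat.gcd_zero_left] at gcop; omega
        · rw [h1, one_pow, Nat.one_mod_eq_one.2 (by omega)] at gM; exact gM rfl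
      · exact pow_ne_one_of_gcd_check hp hpN (o3 ho j hj1 (by omega)).2
    · -- the order `k = os.2` is found: the modulus grows
      obtain ⟨k1, k2, k3, k4⟩ := o4 ho
      set M' := Nat.lcm st.M os.2 with hM'
      have hgrow' : 2 * st.M ≤ M' := two_mul_le_lcm_of_pow hN k1 k3 gM
      have hdvd' : ∀ p, p.Prime → p ∣ N → M' ∣ p - 1 := fun p hp hpN =>
        Nat.lcm_dvd (hdvd p hp hpN) (dvd_pred_of_order_checks k1 k3 (fun j hj1 hj2 => (k4 j hj1 hj2).2) hp hpN)
      have ho1 : os.1 ≠ 1 := by omega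
      have ho2 : os.1 ≠ 2 := by omega
      by_cases hth : TH < M'
      · -- the class scan decides
        have hprime_of : (∀ k', apFirst N M' T3 = some k' → ¬ Nat.gcd (1 + M' * k') N < N) → N.Prime := by
          intro hno
          by_contra hnp
          obtain ⟨k0, hk0, hk0e, hk0sq, hk0lt⟩ := exists_ap_minFac hN hnp hdvd'
          have hk0T : k0 ≤ T3 := by
            have h1 : 1 + M' * k0 ≤ Nat.sqrt N := Nat.le_sqrt.2 hk0sq
            have h2 : M' * k0 < M' * T3 := by
              calc M' * k0 < TH * T3 + 1 := by omega
                _ ≤ M' * T3 := by nlinarith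
            exact (Nat.lt_of_mul_lt_mul_left h2).le
          have hhit : 1 < Nat.gcd (1 + M' * k0) N := by
            rw [hk0e, Nat.gcd_eq_left (Nat.minFac_dvd N)]; exact hmf2
          rcases hap : apFirst N M' T3 with _ | k'
          · exact absurd (apFirst_none hap k0 hk0 hk0T) (by omega)
          · obtain ⟨j1, j2, j3, j4⟩ := apFirst_some hap
            have hk' : k' ≤ k0 := by
              by_contra hlt; exact absurd (j4 k0 hk0 (by omega)) (by omega)
            have hlt : Nat.gcd (1 + M' * k') N < N := by
              have := Nat.le_of_dvd (by omega) (Nat.gcd_dvd_left (1 + M' * k') N)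
              have := Nat.mul_le_mul_left M' hk'
              omega
            exact hno k' hap hlt
        rcases hap : apFirst N M' T3 with _ | k'
        · have hph : faPhase N D TH TR T3 st = ⟨fb.1, M', 3, 0⟩ := by
            simp [faPhase, hres, ← hfb, hc0, hc1, ← hos, ho1, ho2, ← hM', hth, hap]
          rw [hph]
          refine ⟨Or.inr (Or.inr (Or.inr ⟨rfl, hprime_of fun k' hk' _ => by rw [hap] at hk'; exact absurd hk' (by simp)⟩)), f2⟩
        · obtain ⟨j1, j2, j3, j4⟩ := apFirst_some hap
          by_cases hg : Nat.gcd (1 + M' * k') N < N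
          · have hph : faPhase N D TH TR T3 st = ⟨fb.1, M', 1, Nat.gcd (1 + M' * k') N⟩ := by
              simp [faPhase, hres, ← hfb, hc0, hc1, ← hos, ho1, ho2, ← hM', hth, hap, hg]
            rw [hph]
            exact ⟨Or.inr (Or.inl ⟨rfl, j3, hg, Nat.gcd_dvd_right _ _⟩), f2⟩
          · have hph : faPhase N D TH TR T3 st = ⟨fb.1, M', 3, 0⟩ := by
              simp [faPhase, hres, ← hfb, hc0, hc1, ← hos, ho1, ho2, ← hM', hth, hap, hg]
            rw [hph]
            refine ⟨Or.inr (Or.inr (Or.inr ⟨rfl, hprime_of fun k'' hk'' hlt => ?_⟩)), f2⟩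
            rw [hap] at hk''; cases hk''; exact hg hlt
      · -- keep running with the doubled modulus
        have hph : faPhase N D TH TR T3 st = ⟨fb.1, M', 0, 0⟩ := by
          simp [faPhase, hres, ← hfb, hc0, hc1, ← hos, ho1, ho2, ← hM', hth]
        rw [hph]
        refine ⟨Or.inl ⟨by simp only; omega, by simp only; omega, rfl, hdvd', ?_⟩, f2⟩
        simp only [pow_succ]; omega

include hN hTH hTR hTRp hT3 in

/-- **The order supply is correct**: after `PH` rounds with `TH < 2^PH` (and all bases `< N`) the outcome is certified — a proper factor, or a base `α ≤ 1 + PH·TR` coprime to `N` with `α^j ≢ 1 (mod p)` for every prime `p ∣ N` and `1 ≤ j ≤ D`, or “`N` is prime”. [cite: Hittmeir2018, §6, Alg. 6.1 and the theorem after it] -/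
theorem faRun_spec {PH : ℕ} (hPH : TH < 2 ^ PH) (hbd : 1 + PH * TR < N) :
    FaDone N D (1 + PH * TR) (faRun N D TH TR T3 PH) := by
  -- along the iteration: invariant at step t with `a ≤ 1 + t TR`, or done
  have key : ∀ t, t ≤ PH → let st := (faPhase N D TH TR T3)^[t] ⟨1, 1, 0, 0⟩
      st.a ≤ 1 + t * TR ∧ (FaInv N TH t st ∨ FaDone N D (1 + t * TR) st) := by
    intro t
    induction t with
    | zero => intro _; exact ⟨by simp, Or.inl ⟨le_rfl, (show (1 : ℕ) ≤ TH from hTH), rfl, fun p _ _ => one_dvd _, (show 2 ^ 0 ≤ 1 by simp)⟩⟩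
    | succ t ih =>
      intro ht st
      obtain ⟨ha, hst⟩ := ih (by omega)
      have hsucc : st = faPhase N D TH TR T3 ((faPhase N D TH TR T3)^[t] ⟨1, 1, 0, 0⟩) := Function.iterate_succ_apply' _ _ _
      set st0 := (faPhase N D TH TR T3)^[t] ⟨1, 1, 0, 0⟩
      have hbd0 : st0.a + TR < N := by
        have : (t + 1) * TR ≤ PH * TR := Nat.mul_le_mul_right _ ht
        rw [Nat.succ_mul] at this; omega
      obtain ⟨p1, p2⟩ := faPhase_spec (D := D) hN hTR hTRp hT3 t st0 hbd0
      rw [hsucc]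
      rcases hst with hI | hDn
      · obtain ⟨q1, q2⟩ := p1 hI
        refine ⟨by rw [Nat.succ_mul]; omega, ?_⟩
        rcases q1 with q1 | q1
        · exact Or.inl q1
        · refine Or.inr ?_
          rcases q1 with q1 | q1 | q1
          · exact Or.inl q1
          · obtain ⟨r1, r2, r3, r4, r5⟩ := q1; exact Or.inr (Or.inl ⟨r1, r2, r3, by rw [Nat.succ_mul]; omega, r5⟩)
          · exact Or.inr (Or.inr q1)
      · have hne : st0.res ≠ 0 := by rcases hDn with h | h | h <;> omega
        rw [p2 hne]
        refine ⟨by rw [Nat.succ_mul]; omega, Or.inr ?_⟩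
        rcases hDn with h | h | h
        · exact Or.inl h
        · obtain ⟨r1, r2, r3, r4, r5⟩ := h; exact Or.inr (Or.inl ⟨r1, r2, r3, by rw [Nat.succ_mul]; omega, r5⟩)
        · exact Or.inr (Or.inr h)
  obtain ⟨-, hfin⟩ := key PH le_rfl
  rcases hfin with hI | hDn
  · exfalso
    have := hI.hgrow; have := hI.hMTH; omega
  · exact hDn

end Run

end OrderSupply

end Literature.Computability.Cryptography.Harvey2021
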